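import Summits.SmoothPoincare4.SmoothPoincare4.Theorems.HeegaardHandlebodyCongruenceClosed.Negative.Gate
import Literature.GroupTheory.CombinatorialGroupTheory.MagnusResidualNilpotence

/-!
# `NilpotentApproximation` (item stmt-SmoothPoincare4-14856, route CongruenceShadows) — structure I:
the item is exactly coherence of the level-wise standardisations

Sorry-free structure lemmas for the crux-grade support item
`Summit.SmoothPoincare4.SmoothPoincare4.Theses.CongruenceShadows.NilpotentApproximation`
(`--supports` the item). The item reads: a `(3+3m, m+1)` group trisection `K` of the trivial group
with Waldhausen pairs whose NILPOTENT shadows are all standard — for every `c` some `ψ_c ∈ Aut S`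
with `ψ_c(Nᵢ·γ_{c+2}S) = Kᵢ·γ_{c+2}S`, `i = 0,1,2` (`S = S m = S_{3+3m}`, `N = N m = s4Kernels.stabilizeIter m`,
`γ_{c+2}S = (⊤ : Subgroup S).lowerCentralSeries (c+1)`) — is standard: `TrisectionKernels.Iso N K`.

* §1 `iInf_sup_lowerCentralSeries_eq` — if `G ⧸ Q` is residually nilpotent then `⋂_c Q·γ_{c+2}G = Q`;
  for the kernels of a group trisection (`S/Kᵢ ≅ F_g` free) this is Magnus' theorem (free groups are
  residually nilpotent: `Literature/GroupTheory/CombinatorialGroupTheory/MagnusResidualNilpotence.lean`,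
  `freeGroup_iInf_lowerCentralSeries_eq_bot`, Lyndon–Schupp Ch. I Prop. 10.2), giving
  `iInf_sup_lowerCentralSeries_eq_of_free` unconditionally: handlebody-type kernels are CLOSED in the
  nilpotent topology of `S_g`.
* §2 `levels_antitone` — a level-`(c+1)` standardisation is a level-`c` standardisation: the solution
  sets `X_c = {ψ | ∀ i, ψ(Nᵢ·γ_{c+2}) = Kᵢ·γ_{c+2}}` form a DECREASING tower of cosets `ψ_c · Stab_c` of the
  level stabilisers (`levelSolutions_differ`, `levelSolution_of_stab`); `iso_of_coherent` — ONE `ψ`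
  lying in every `X_c` is an isomorphism `ψ(Nᵢ) = Kᵢ`; `stab_of_forall_levelStab` — `⋂_c Stab_c` is the
  trisection group `Stab N₀ ∩ Stab N₁ ∩ Stab N₂` (no finite level suffices);
  `coherent_of_finiteDetermination` — the one cheap mechanism that WOULD prove the item (level
  stabilisers factoring through the trisection group from some depth on; not expected to hold);
  `nilpotentApproximation_iff_coherentLevels` — the item is EXACTLY "`⋂_c X_c ≠ ∅` whenever every
  `X_c ≠ ∅`", an integral Mittag-Leffler statement for the tower `X_c = ψ_c · Stab_c` in `Aut S` (the
  honest residual recorded in the route file: "the standardisations `ψ_c` need not stabilise in `c`").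

Part II (`CongruenceShadowsNilpotentApproximationGate.lean`): slot normalisation and the gate form, and
the logical position of the item in the route.

No new definitions; vocabulary (`S`, `N`, `map_trans`, `N_isGroupTrisection`) from the imported landed
negative-side support file `Theorems/HeegaardHandlebodyCongruenceClosed/Negative/Gate.lean`; the small
`map` algebra (`map_refl`, `map_symm_of_map_eq`) is as in
`Theorems/CongruenceShadowsCongruenceApproximableStructure.lean` (item 14855), restated here to keep
the import cone to already-built modules.
-/

-- the prescribed namespace `Summit.<P>.<Sub>.…` duplicates `SmoothPoincare4` (P = Sub)
set_option linter.dupNamespace false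

noncomputable section

namespace Summit.SmoothPoincare4.SmoothPoincare4.Theorems.NilpotentApproximation

open Literature.Topology.FourManifolds Subgroup
open Summit.SmoothPoincare4.SmoothPoincare4.Theses.CongruenceShadows
open Summit.SmoothPoincare4.SmoothPoincare4.Theorems.HeegaardHandlebodyCongruenceClosed.Negative
  (S N map_trans N_isGroupTrisection)

/-! ## §0 Elementary `map` algebra for automorphisms -/

/-- `map` along the identity automorphism. [folklore] -/
theorem map_refl {m : ℕ} (H : Subgroup (S m)) : H.map (MulEquiv.refl (S m)).toMonoidHom = H := by
  ext s
  simp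

/-- `eH = L ⇒ e⁻¹L = H`. [folklore] -/
theorem map_symm_of_map_eq {m : ℕ} {e : S m ≃* S m} {H L : Subgroup (S m)}
    (h : H.map e.toMonoidHom = L) : L.map e.symm.toMonoidHom = H := by
  rw [← h, ← map_trans, MulEquiv.self_trans_symm, map_refl]

/-! ## §1 Residual nilpotence of quotients and the intersection `⋂_c Q·γ_{c+2} = Q` -/

section residual

variable {G : Type*} [Group G]

/-- Residual nilpotence (`⋂ₙ γₙ = 1`) is invariant under group isomorphism. [folklore] -/
theorem iInf_lowerCentralSeries_eq_bot_of_mulEquiv {H : Type*} [Group H] (e : G ≃* H)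
    (h : ⨅ n, (⊤ : Subgroup G).lowerCentralSeries n = ⊥) :
    ⨅ n, (⊤ : Subgroup H).lowerCentralSeries n = ⊥ := by
  have hn : ∀ n, (⊤ : Subgroup H).lowerCentralSeries n =
      ((⊤ : Subgroup G).lowerCentralSeries n).map e.toMonoidHom := fun n => by
    rw [Subgroup.map_lowerCentralSeries, Subgroup.map_top_of_surjective _ e.surjective]
  rw [eq_bot_iff]
  intro x hx
  rw [Subgroup.mem_iInf] at hx
  have hx' : e.symm x ∈ ⨅ n, (⊤ : Subgroup G).lowerCentralSeries n := by
    rw [Subgroup.mem_iInf]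
    intro n
    have hn' := hx n
    rw [hn n] at hn'
    obtain ⟨y, hy, hyx⟩ := hn'
    have : e.symm x = y := by rw [← hyx]; simp
    rw [this]
    exact hy
  rw [h, Subgroup.mem_bot] at hx'
  rw [Subgroup.mem_bot]
  simpa using congrArg e hx'

/-- If `G ⧸ Q` is residually nilpotent then `⋂_c Q ⊔ γ_{c+2}(G) = Q`. [folklore] -/
theorem iInf_sup_lowerCentralSeries_eq (Q : Subgroup G) [Q.Normal]
    (h : ⨅ n, (⊤ : Subgroup (G ⧸ Q)).lowerCentralSeries n = ⊥) :
    ⨅ c, Q ⊔ (⊤ : Subgroup G).lowerCentralSeries (c + 1) = Q := by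
  have key : ∀ n, Q ⊔ (⊤ : Subgroup G).lowerCentralSeries n =
      ((⊤ : Subgroup (G ⧸ Q)).lowerCentralSeries n).comap (QuotientGroup.mk' Q) := fun n => by
    rw [← Subgroup.map_top_of_surjective _ (QuotientGroup.mk'_surjective Q),
      ← Subgroup.map_lowerCentralSeries, Subgroup.comap_map_eq, QuotientGroup.ker_mk', sup_comm]
  apply le_antisymm
  · intro x hx
    rw [Subgroup.mem_iInf] at hx
    have hx' : (QuotientGroup.mk' Q x) ∈ ⨅ n, (⊤ : Subgroup (G ⧸ Q)).lowerCentralSeries n := by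
      rw [Subgroup.mem_iInf]
      intro n
      cases n with
      | zero => exact Subgroup.mem_top _
      | succ n =>
        have := hx n
        rw [key] at this
        exact this
    rw [h, Subgroup.mem_bot, QuotientGroup.mk'_apply, QuotientGroup.eq_one_iff] at hx'
    exact hx'
  · exact le_iInf fun n => le_sup_left

end residual

/-- The kernels of a group trisection have free quotients (normal-closure bookkeeping). [folklore] -/
theorem isFreeOfRank_quotient_of_isGroupTrisection {g k : ℕ} {G : Type*} [Group G]
    {K : TrisectionKernels g} (hK : IsGroupTrisection g k G K) (i : Fin 3) [(K i).Normal] :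
    IsFreeOfRank (SurfaceGroup g ⧸ K i) g :=
  (hK.free_quotient i).of_mulEquiv (QuotientGroup.quotientMulEquivOfEq (normalClosure_eq_self _))

/-- **Handlebody-type kernels are closed in the nilpotent topology**: a normal subgroup of `S_g` with
free quotient of some rank is the intersection of its nilpotent thickenings, `⋂_c Q·γ_{c+2}(S_g) = Q`
(Magnus' theorem: free groups are residually nilpotent, `freeGroup_iInf_lowerCentralSeries_eq_bot`).
[cite: LyndonSchupp2001, Ch. I Prop. 10.2] -/
theorem iInf_sup_lowerCentralSeries_eq_of_free {g n : ℕ}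
    (Q : Subgroup (SurfaceGroup g)) [Q.Normal] (hQ : IsFreeOfRank (SurfaceGroup g ⧸ Q) n) :
    ⨅ c, Q ⊔ (⊤ : Subgroup (SurfaceGroup g)).lowerCentralSeries (c + 1) = Q := by
  obtain ⟨e⟩ := hQ
  exact iInf_sup_lowerCentralSeries_eq Q (iInf_lowerCentralSeries_eq_bot_of_mulEquiv e
    (Literature.GroupTheory.CombinatorialGroupTheory.freeGroup_iInf_lowerCentralSeries_eq_bot (Fin n)))

/-! ## §2 The tower of level solutions; coherence is exactly the item -/

/-- `γ_{c+2}` is `Aut S`-invariant. [folklore] -/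
theorem map_lcs {m : ℕ} (ψ : S m ≃* S m) (c : ℕ) :
    ((⊤ : Subgroup (S m)).lowerCentralSeries c).map ψ.toMonoidHom = (⊤ : Subgroup (S m)).lowerCentralSeries c := by
  rw [Subgroup.map_lowerCentralSeries, Subgroup.map_top_of_surjective _ ψ.surjective]

/-- **The tower of solution sets decreases**: a level-`(c+1)` standardisation of `K` is a level-`c`
standardisation (`γ_{c+3} ≤ γ_{c+2}`, both characteristic). [folklore] -/
theorem levels_antitone {m : ℕ} {K : TrisectionKernels (3 + 3 * m)} {ψ : S m ≃* S m} {c : ℕ}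
    (h : ∀ i : Fin 3, (N m i ⊔ (⊤ : Subgroup (S m)).lowerCentralSeries (c + 1 + 1)).map ψ.toMonoidHom =
      K i ⊔ (⊤ : Subgroup (S m)).lowerCentralSeries (c + 1 + 1)) (i : Fin 3) :
    (N m i ⊔ (⊤ : Subgroup (S m)).lowerCentralSeries (c + 1)).map ψ.toMonoidHom =
      K i ⊔ (⊤ : Subgroup (S m)).lowerCentralSeries (c + 1) := by
  have hle : (⊤ : Subgroup (S m)).lowerCentralSeries (c + 1 + 1) ≤ (⊤ : Subgroup (S m)).lowerCentralSeries (c + 1) :=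
    Subgroup.lowerCentralSeries_antitone ⊤ (Nat.le_succ _)
  have e1 : N m i ⊔ (⊤ : Subgroup (S m)).lowerCentralSeries (c + 1) =
      (N m i ⊔ (⊤ : Subgroup (S m)).lowerCentralSeries (c + 1 + 1)) ⊔ (⊤ : Subgroup (S m)).lowerCentralSeries (c + 1) := by
    rw [sup_assoc, sup_eq_right.2 hle]
  have e2 : K i ⊔ (⊤ : Subgroup (S m)).lowerCentralSeries (c + 1) =
      (K i ⊔ (⊤ : Subgroup (S m)).lowerCentralSeries (c + 1 + 1)) ⊔ (⊤ : Subgroup (S m)).lowerCentralSeries (c + 1) := by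
    rw [sup_assoc, sup_eq_right.2 hle]
  rw [e1, Subgroup.map_sup, h i, map_lcs, ← e2]

/-- Hence a level-`c'` standardisation is a level-`c` standardisation for every `c ≤ c'`. [folklore] -/
theorem levels_antitone' {m : ℕ} {K : TrisectionKernels (3 + 3 * m)} {ψ : S m ≃* S m} {c c' : ℕ}
    (hcc' : c ≤ c')
    (h : ∀ i : Fin 3, (N m i ⊔ (⊤ : Subgroup (S m)).lowerCentralSeries (c' + 1)).map ψ.toMonoidHom =
      K i ⊔ (⊤ : Subgroup (S m)).lowerCentralSeries (c' + 1)) (i : Fin 3) :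
    (N m i ⊔ (⊤ : Subgroup (S m)).lowerCentralSeries (c + 1)).map ψ.toMonoidHom =
      K i ⊔ (⊤ : Subgroup (S m)).lowerCentralSeries (c + 1) := by
  induction c' with
  | zero =>
    obtain rfl : c = 0 := Nat.le_zero.1 hcc'
    exact h i
  | succ c' ih =>
    rcases Nat.lt_or_eq_of_le hcc' with hlt | rfl
    · exact ih (Nat.lt_succ_iff.1 hlt) (fun j => levels_antitone h j)
    · exact h i

/-- **One-sided containment from coherent levels.** If `ψ(P ⊔ γ) ≤ Q ⊔ γ` at every level
`γ = γ_{c+2}(S_g)` and `⋂_c Q ⊔ γ_{c+2} = Q`, then `ψ(P) ≤ Q`. [folklore] -/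
theorem map_le_of_levels {g : ℕ} (ψ : SurfaceGroup g ≃* SurfaceGroup g) (P Q : Subgroup (SurfaceGroup g))
    (hQ : ⨅ c, Q ⊔ (⊤ : Subgroup (SurfaceGroup g)).lowerCentralSeries (c + 1) = Q)
    (h : ∀ c : ℕ, (P ⊔ (⊤ : Subgroup (SurfaceGroup g)).lowerCentralSeries (c + 1)).map ψ.toMonoidHom ≤
      Q ⊔ (⊤ : Subgroup (SurfaceGroup g)).lowerCentralSeries (c + 1)) :
    P.map ψ.toMonoidHom ≤ Q := by
  rw [← hQ]
  exact le_iInf fun c => le_trans (Subgroup.map_mono le_sup_left) (h c)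

/-- **Coherent standardisation ⟹ isomorphism.** If ONE automorphism `ψ` of
`S_(3+3m)` standardises a `(3+3m, m+1)` group trisection `K` of the trivial group at EVERY nilpotent
level — `ψ(Nᵢ·γ_{c+2}) = Kᵢ·γ_{c+2}` for all `c` and `i` — then `ψ(Nᵢ) = Kᵢ` (so `Iso N K`): both
`S/Kᵢ ≅ F_g` and `S/Nᵢ ≅ F_g` are residually nilpotent, so `Kᵢ = ⋂_c Kᵢ·γ_{c+2}` bounds `ψ(Nᵢ)` from
above and `Nᵢ = ⋂_c Nᵢ·γ_{c+2}` bounds `ψ⁻¹(Kᵢ)` (Magnus). [folklore] -/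
theorem iso_of_coherent (m : ℕ) (K : TrisectionKernels (3 + 3 * m)) (hK : IsGroupTrisection (3 + 3 * m) (m + 1) (PUnit : Type) K)
    (ψ : S m ≃* S m)
    (hψ : ∀ (c : ℕ) (i : Fin 3), (N m i ⊔ (⊤ : Subgroup (S m)).lowerCentralSeries (c + 1)).map ψ.toMonoidHom =
      K i ⊔ (⊤ : Subgroup (S m)).lowerCentralSeries (c + 1)) :
    ∀ i, (N m i).map ψ.toMonoidHom = K i := by
  intro i
  haveI := hK.normal i
  have hKi := iInf_sup_lowerCentralSeries_eq_of_free (K i) (isFreeOfRank_quotient_of_isGroupTrisection hK i)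
  have hNi := iInf_sup_lowerCentralSeries_eq_of_free (N m i)
    (isFreeOfRank_quotient_of_isGroupTrisection (N_isGroupTrisection m) i)
  apply le_antisymm
  · exact map_le_of_levels ψ _ _ hKi fun c => le_of_eq (hψ c i)
  · have h' : (K i).map ψ.symm.toMonoidHom ≤ N m i := by
      refine map_le_of_levels ψ.symm _ _ hNi fun c => le_of_eq ?_
      rw [Subgroup.map_sup, map_lcs, ← map_symm_of_map_eq (hψ c i), Subgroup.map_sup, map_lcs]
    intro x hx
    exact ⟨ψ.symm x, h' ⟨x, hx, rfl⟩, by simp⟩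

/-- **Coherent levels ⟹ the item**: if under the item's hypotheses ONE automorphism standardises every
nilpotent level, the item holds (`iso_of_coherent`). [folklore] -/
theorem nilpotentApproximation_of_coherentLevels
    (h : ∀ (m : ℕ) (K : TrisectionKernels (3 + 3 * m)),
      IsGroupTrisection (3 + 3 * m) (m + 1) (PUnit : Type) K →
      (∀ i j : Fin 3, i ≠ j → ∃ α : S m ≃* S m, (N m i).map α.toMonoidHom = K i ∧ (N m j).map α.toMonoidHom = K j) →
      (∀ c : ℕ, ∃ ψ : S m ≃* S m, ∀ i : Fin 3,
        (N m i ⊔ (⊤ : Subgroup (S m)).lowerCentralSeries (c + 1)).map ψ.toMonoidHom =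
          K i ⊔ (⊤ : Subgroup (S m)).lowerCentralSeries (c + 1)) →
      ∃ ψ : S m ≃* S m, ∀ (c : ℕ) (i : Fin 3),
        (N m i ⊔ (⊤ : Subgroup (S m)).lowerCentralSeries (c + 1)).map ψ.toMonoidHom =
          K i ⊔ (⊤ : Subgroup (S m)).lowerCentralSeries (c + 1)) :
    NilpotentApproximation := by
  intro m K hK hW hS
  obtain ⟨ψ, hψ⟩ := h m K hK hW hS
  exact ⟨ψ, iso_of_coherent m K hK ψ hψ⟩

/-- **The level stabilisers converge to the trisection group**: an automorphism stabilising the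
standard shadow triple at EVERY nilpotent level stabilises `N` itself (`iso_of_coherent` at `K = N`);
so `⋂_c Stab_c = Stab N₀ ∩ Stab N₁ ∩ Stab N₂`, although no finite level suffices. [folklore] -/
theorem stab_of_forall_levelStab {m : ℕ} {φ : S m ≃* S m}
    (hφ : ∀ (c : ℕ) (i : Fin 3), (N m i ⊔ (⊤ : Subgroup (S m)).lowerCentralSeries (c + 1)).map φ.toMonoidHom =
      N m i ⊔ (⊤ : Subgroup (S m)).lowerCentralSeries (c + 1)) :
    ∀ i, (N m i).map φ.toMonoidHom = N m i :=
  iso_of_coherent m (N m) (N_isGroupTrisection m) φ hφ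

/-- Level stabilisers, read back: `φ` stabilises every level iff it stabilises `N`. [folklore] -/
theorem forall_levelStab_iff {m : ℕ} (φ : S m ≃* S m) :
    (∀ (c : ℕ) (i : Fin 3), (N m i ⊔ (⊤ : Subgroup (S m)).lowerCentralSeries (c + 1)).map φ.toMonoidHom =
      N m i ⊔ (⊤ : Subgroup (S m)).lowerCentralSeries (c + 1)) ↔ ∀ i, (N m i).map φ.toMonoidHom = N m i :=
  ⟨stab_of_forall_levelStab, fun h c i => by rw [Subgroup.map_sup, h i, map_lcs]⟩

/-- **Torsor structure of one level**: two level-`c` standardisations of the same `K` differ by a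
level-`c` stabiliser of the standard shadow triple (`X_c = ψ_c · Stab_c`). [folklore] -/
theorem levelSolutions_differ {m : ℕ} {K : TrisectionKernels (3 + 3 * m)} {ψ ψ' : S m ≃* S m} {c : ℕ}
    (hψ : ∀ i : Fin 3, (N m i ⊔ (⊤ : Subgroup (S m)).lowerCentralSeries (c + 1)).map ψ.toMonoidHom =
      K i ⊔ (⊤ : Subgroup (S m)).lowerCentralSeries (c + 1))
    (hψ' : ∀ i : Fin 3, (N m i ⊔ (⊤ : Subgroup (S m)).lowerCentralSeries (c + 1)).map ψ'.toMonoidHom =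
      K i ⊔ (⊤ : Subgroup (S m)).lowerCentralSeries (c + 1)) (i : Fin 3) :
    (N m i ⊔ (⊤ : Subgroup (S m)).lowerCentralSeries (c + 1)).map (ψ'.trans ψ.symm).toMonoidHom =
      N m i ⊔ (⊤ : Subgroup (S m)).lowerCentralSeries (c + 1) := by
  rw [map_trans, hψ' i, map_symm_of_map_eq (hψ i)]

/-- … and conversely a level-`c` stabiliser followed by a level-`c` standardisation is again a level-`c`
standardisation. [folklore] -/
theorem levelSolution_of_stab {m : ℕ} {K : TrisectionKernels (3 + 3 * m)} {ψ φ : S m ≃* S m} {c : ℕ}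
    (hψ : ∀ i : Fin 3, (N m i ⊔ (⊤ : Subgroup (S m)).lowerCentralSeries (c + 1)).map ψ.toMonoidHom =
      K i ⊔ (⊤ : Subgroup (S m)).lowerCentralSeries (c + 1))
    (hφ : ∀ i : Fin 3, (N m i ⊔ (⊤ : Subgroup (S m)).lowerCentralSeries (c + 1)).map φ.toMonoidHom =
      N m i ⊔ (⊤ : Subgroup (S m)).lowerCentralSeries (c + 1)) (i : Fin 3) :
    (N m i ⊔ (⊤ : Subgroup (S m)).lowerCentralSeries (c + 1)).map (φ.trans ψ).toMonoidHom =
      K i ⊔ (⊤ : Subgroup (S m)).lowerCentralSeries (c + 1) := by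
  rw [map_trans, hφ i, hψ i]

/-- An exact stabiliser of `N` is a level stabiliser at every level. [folklore] -/
theorem levelStab_of_stab {m : ℕ} {t : S m ≃* S m} (ht : ∀ i, (N m i).map t.toMonoidHom = N m i) (c : ℕ)
    (i : Fin 3) :
    (N m i ⊔ (⊤ : Subgroup (S m)).lowerCentralSeries (c + 1)).map t.toMonoidHom =
      N m i ⊔ (⊤ : Subgroup (S m)).lowerCentralSeries (c + 1) := by
  rw [Subgroup.map_sup, ht i, map_lcs]

/-- **A sufficient condition: finite determination of the tower.** Suppose that from some depth `c₀`
on the level stabilisers of the standard shadow triple FACTOR through the trisection group: every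
`φ ∈ Stab_{c₀}` is `t ∘ g` with `t ∈ Stab N₀ ∩ Stab N₁ ∩ Stab N₂` and `g ∈ Stab_c`, for each `c ≥ c₀`.
Then every level-`c₀` standardisation `ψ` of a `K` admitting standardisations at all levels is
coherent (`ψ ∈ X_c` for all `c`), hence an isomorphism `ψ(Nᵢ) = Kᵢ` for `K` a group trisection
(`iso_of_coherent`). Proof: `ψ⁻¹ψ_c ∈ Stab_{c₀}` factors as `t ∘ g`, so `ψ ∘ t = ψ_c ∘ g⁻¹ ∈ X_c` and
`ψ = (ψ ∘ t) ∘ t⁻¹ ∈ X_c`. (Recorded as the one cheap mechanism that WOULD prove the item; the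
factorisation hypothesis is not expected to hold — `Stab_{c₀}` contains the `c₀`-th Johnson kernel of
`Aut S`, whose level-`c` action is not that of trisection symmetries.) [folklore] -/
theorem coherent_of_finiteDetermination {m : ℕ} {K : TrisectionKernels (3 + 3 * m)} (c₀ : ℕ)
    (hfac : ∀ c : ℕ, c₀ ≤ c → ∀ φ : S m ≃* S m,
      (∀ i : Fin 3, (N m i ⊔ (⊤ : Subgroup (S m)).lowerCentralSeries (c₀ + 1)).map φ.toMonoidHom =
        N m i ⊔ (⊤ : Subgroup (S m)).lowerCentralSeries (c₀ + 1)) →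
      ∃ t g : S m ≃* S m, (∀ i, (N m i).map t.toMonoidHom = N m i) ∧
        (∀ i : Fin 3, (N m i ⊔ (⊤ : Subgroup (S m)).lowerCentralSeries (c + 1)).map g.toMonoidHom =
          N m i ⊔ (⊤ : Subgroup (S m)).lowerCentralSeries (c + 1)) ∧ φ = g.trans t)
    (hS : ∀ c : ℕ, ∃ ψ : S m ≃* S m, ∀ i : Fin 3,
      (N m i ⊔ (⊤ : Subgroup (S m)).lowerCentralSeries (c + 1)).map ψ.toMonoidHom =
        K i ⊔ (⊤ : Subgroup (S m)).lowerCentralSeries (c + 1))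
    {ψ : S m ≃* S m}
    (hψ : ∀ i : Fin 3, (N m i ⊔ (⊤ : Subgroup (S m)).lowerCentralSeries (c₀ + 1)).map ψ.toMonoidHom =
      K i ⊔ (⊤ : Subgroup (S m)).lowerCentralSeries (c₀ + 1)) :
    ∀ (c : ℕ) (i : Fin 3), (N m i ⊔ (⊤ : Subgroup (S m)).lowerCentralSeries (c + 1)).map ψ.toMonoidHom =
      K i ⊔ (⊤ : Subgroup (S m)).lowerCentralSeries (c + 1) := by
  intro c
  by_cases hc : c₀ ≤ c
  · obtain ⟨ψc, hψc⟩ := hS c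
    -- `φ := ψ⁻¹ ∘ ψ_c ∈ Stab_{c₀}`
    obtain ⟨t, g, ht, hg, htg⟩ := hfac c hc (ψc.trans ψ.symm) (levelSolutions_differ hψ (levels_antitone' hc hψc))
    -- `ψ ∘ t = ψ_c ∘ g⁻¹`
    have e : t.trans ψ = g.symm.trans ψc := by
      ext s
      have h := MulEquiv.congr_fun htg (g.symm s)
      simp only [MulEquiv.trans_apply, MulEquiv.apply_symm_apply] at h
      show ψ (t s) = ψc (g.symm s)
      rw [← h, MulEquiv.apply_symm_apply]
    have hg' : ∀ i : Fin 3, (N m i ⊔ (⊤ : Subgroup (S m)).lowerCentralSeries (c + 1)).map g.symm.toMonoidHom =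
        N m i ⊔ (⊤ : Subgroup (S m)).lowerCentralSeries (c + 1) := fun i => map_symm_of_map_eq (hg i)
    have h1 : ∀ i : Fin 3, (N m i ⊔ (⊤ : Subgroup (S m)).lowerCentralSeries (c + 1)).map (t.trans ψ).toMonoidHom =
        K i ⊔ (⊤ : Subgroup (S m)).lowerCentralSeries (c + 1) := by
      rw [e]
      exact levelSolution_of_stab hψc hg'
    -- `ψ = (ψ ∘ t) ∘ t⁻¹`
    have e2 : ψ = t.symm.trans (t.trans ψ) := by
      ext s
      simp
    have ht' : ∀ i, (N m i).map t.symm.toMonoidHom = N m i := fun i => map_symm_of_map_eq (ht i)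
    rw [e2]
    exact levelSolution_of_stab h1 (levelStab_of_stab ht' c)
  · exact levels_antitone' (le_of_not_ge hc) hψ

/-- **The item ⟹ coherent levels** (unconditionally): the isomorphism `α` of the conclusion is a
standardisation at every level (`γ_{c+2}` is characteristic). [folklore] -/
theorem coherentLevels_of_nilpotentApproximation (h : NilpotentApproximation) :
    ∀ (m : ℕ) (K : TrisectionKernels (3 + 3 * m)),
      IsGroupTrisection (3 + 3 * m) (m + 1) (PUnit : Type) K →
      (∀ i j : Fin 3, i ≠ j → ∃ α : S m ≃* S m, (N m i).map α.toMonoidHom = K i ∧ (N m j).map α.toMonoidHom = K j) →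
      (∀ c : ℕ, ∃ ψ : S m ≃* S m, ∀ i : Fin 3,
        (N m i ⊔ (⊤ : Subgroup (S m)).lowerCentralSeries (c + 1)).map ψ.toMonoidHom =
          K i ⊔ (⊤ : Subgroup (S m)).lowerCentralSeries (c + 1)) →
      ∃ ψ : S m ≃* S m, ∀ (c : ℕ) (i : Fin 3),
        (N m i ⊔ (⊤ : Subgroup (S m)).lowerCentralSeries (c + 1)).map ψ.toMonoidHom =
          K i ⊔ (⊤ : Subgroup (S m)).lowerCentralSeries (c + 1) := by
  intro m K hK hW hS
  obtain ⟨α, hα⟩ := h m K hK hW hS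
  exact ⟨α, fun c i => by rw [Subgroup.map_sup, hα i, map_lcs]⟩

/-- **The item is EXACTLY coherence of the level-wise standardisations**: `NilpotentApproximation`
holds iff, under its own hypotheses, the standardisations `ψ_c` can be chosen equal for all `c` — an
integral Mittag-Leffler statement for the decreasing tower of solution cosets `X_c = ψ_c · Stab_c`
in `Aut S_(3+3m)` (`levels_antitone`); nothing in the hypotheses bounds the depth. [folklore] -/
theorem nilpotentApproximation_iff_coherentLevels :
    NilpotentApproximation ↔ ∀ (m : ℕ) (K : TrisectionKernels (3 + 3 * m)),
      IsGroupTrisection (3 + 3 * m) (m + 1) (PUnit : Type) K →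
      (∀ i j : Fin 3, i ≠ j → ∃ α : S m ≃* S m, (N m i).map α.toMonoidHom = K i ∧ (N m j).map α.toMonoidHom = K j) →
      (∀ c : ℕ, ∃ ψ : S m ≃* S m, ∀ i : Fin 3,
        (N m i ⊔ (⊤ : Subgroup (S m)).lowerCentralSeries (c + 1)).map ψ.toMonoidHom =
          K i ⊔ (⊤ : Subgroup (S m)).lowerCentralSeries (c + 1)) →
      ∃ ψ : S m ≃* S m, ∀ (c : ℕ) (i : Fin 3),
        (N m i ⊔ (⊤ : Subgroup (S m)).lowerCentralSeries (c + 1)).map ψ.toMonoidHom =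
          K i ⊔ (⊤ : Subgroup (S m)).lowerCentralSeries (c + 1) :=
  ⟨coherentLevels_of_nilpotentApproximation, nilpotentApproximation_of_coherentLevels⟩

end Summit.SmoothPoincare4.SmoothPoincare4.Theorems.NilpotentApproximation

end
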